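import Literature.IUT.HodgeTheaters.PiAvatarLocalAmbient
import Literature.IUT.HodgeTheaters.PiAvatarLocalOvergroupUnd
import Literature.IUT.HodgeTheaters.PiAvatarNegCompatBad
import HarnessLib

/-!
# KIT-INSTANCE-SPEC P5-binding (IV-b, bad places): the local datum of a BAD place `v̲` from the SHAPE-OF-RECORD pair
# `Π_v̲ := H_v ≤ H′_v` (profinite avatars of `Π^tp_{X̲̳_v̲} ≤ Π^tp_{C̲̳_v̲}`) — `±`-overgroup `Π_{X̲_K} ∩ augGF⁻¹ G_v̲`, normaliser step,
# `±`-involution ([IUTchI] Def 3.1 (e), Ex 3.2 (i), Def 6.1 (ii)(iii); one def — post-freeze additive D13, not a cone member)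

S. Mochizuki, *Inter-universal Teichmüller theory I*, kurims manuscript (May 2020), Def 3.1 (e) p. 63 («If `v̲ ∈ V̲^bad`, then … `Π_v̲ :=
Π^tp_{X̲̳_v̲}`»; `Π_{X̲̳_v̲} ⊆ Π_{C̲̳_v̲} ⊆ Π_{C_v̲}`), Ex 3.2 (i) p. 69 (`𝒟_v := ℬ^temp(X̲̳_v)⁰`), Def 6.1 (ii) p. 156 (`†𝒟_v^±` «corresponding to
`X̲_v`» — [EtTh] Prop 2.4 if `v ∈ V^bad`), Def 6.1 (iii) p. 157 ([IUTchI] Def 6.1 (ii) p.156) [claim: Mochizuki2012, status: disputed] (D-0012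
claim key, series status DISPUTED — a definition over abc-iut-L5-t2's REAL `InitialThetaData`, under the binders `hS`, the SHAPE-OF-RECORD pair
of GAP G-L5t4g3-2 (iii) (abc-iut-L5-lead RULINGS #36 (4)) for the place, its decomposition group `G_v̲`, and the local arrow law `Λ` of `H_v`;
nothing of the series is asserted, no side is taken on [IUTchIII] Cor. 3.12).

## What is built
**`InitialThetaData.LocalDatum.ofBad … : D.LocalDatum CG hS`** for a pair `H ≤ H′ ≤ Π_{C̲_K}`, `[H′ : H] = 2`, `H′ ∩ Π_{X̲_K} ≤ H` (abc-iut-L5-t13's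
`PiAvatarNegCompatBad` shape, p435801) lying over a decomposition group `G_v̲` (`H ≤ Π_{X̲_K} ∩ augGF⁻¹ G_v̲`, `augGF(H) = G_K ∩ G_v̲`) with
local arrow law `Λ`: `H := H`, `Hund := Π_{X̲_K} ∩ augGF⁻¹ G_v̲` (the type-(1,l-tors) object «corresponding to `X̲_v`»), the normaliser step
`N(H) ≤ N(Hund)` DERIVED from `Λ` and `augGF(H) = G_K ∩ G_v̲` (`conj_smul_PiXund_inf_eq_of_law`), and the negative element = abc-iut-L5-t13's
`exists_bad_involution_mem` (the deck transformation `ι_v̲ ∈ H′ ∖ H`). So `baseKitOfData`/`placeKitOfData` and the laws (α)(β) apply at bad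
places with binders: the pair, `G_v̲`-compatibility, `Λ`. No instance, no notation; typed ≠ proved elsewhere; binder ≠ fact.
-/

noncomputable section

namespace Literature.IUT.HodgeTheaters

open CategoryTheory
open scoped Pointwise

universe u v w

/-! ### Plumbing (private) -/

section PlumbingBad

variable {P Q : Type*} [Group P] [Group Q]

/-- `a • f⁻¹ T = f⁻¹ (f a • T)`. [folklore] -/
private theorem bad_conj_smul_comap_eq (f : P →* Q) (T : Subgroup Q) (a : P) :
    MulAut.conj a • T.comap f = (MulAut.conj (f a) • T).comap f := by
  ext x
  rw [Subgroup.mem_pointwise_smul_iff_inv_smul_mem, Subgroup.mem_comap, Subgroup.mem_comap,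
    Subgroup.mem_pointwise_smul_iff_inv_smul_mem, MulAut.smul_def, MulAut.conj_inv_apply, MulAut.smul_def,
    MulAut.conj_inv_apply, map_mul, map_mul, map_inv]

/-- If `a` normalises `S` and `f(S) = T` then `f a • T ≤ T`. [folklore] -/
private theorem bad_conj_smul_le_of_map_eq (f : P →* Q) {S : Subgroup P} {T : Subgroup Q} (hS : S.map f = T)
    {b : P} (hb : b ∈ Subgroup.normalizer (S : Set P)) : MulAut.conj (f b) • T ≤ T := by
  intro x hx
  rw [Subgroup.mem_pointwise_smul_iff_inv_smul_mem, ← hS] at hx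
  obtain ⟨s, hs, hsx⟩ := hx
  rw [← hS]
  refine ⟨b * s * b⁻¹, (Subgroup.mem_normalizer_iff.mp hb s).mp hs, ?_⟩
  rw [map_mul, map_mul, map_inv, hsx, MulAut.smul_def, MulAut.conj_inv_apply]
  group

/-- If `a` normalises `S` and `f(S) = T` then `f a • T = T`. [folklore] -/
private theorem bad_conj_smul_eq_of_map_eq (f : P →* Q) {S : Subgroup P} {T : Subgroup Q} (hS : S.map f = T)
    {a : P} (ha : a ∈ Subgroup.normalizer (S : Set P)) : MulAut.conj (f a) • T = T := by
  refine le_antisymm (bad_conj_smul_le_of_map_eq f hS ha) fun x hx => ?_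
  have h' := bad_conj_smul_le_of_map_eq f hS ((Subgroup.normalizer (S : Set P)).inv_mem ha)
  have hx' : (MulAut.conj (f a))⁻¹ • x ∈ T := by
    refine h' ?_
    rw [map_inv, map_inv]
    exact Subgroup.smul_mem_pointwise_smul _ _ _ hx
  exact Subgroup.mem_pointwise_smul_iff_inv_smul_mem.mpr hx'

/-- `a • T = T ⇒ a ∈ N(T)`. [folklore] -/
private theorem bad_mem_normalizer_of_conj_smul_eq {T : Subgroup P} {a : P} (h : MulAut.conj a • T = T) :
    a ∈ Subgroup.normalizer (T : Set P) := by
  rw [Subgroup.mem_set_normalizer_iff]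
  intro x
  rw [SetLike.mem_coe, SetLike.mem_coe, ← MulAut.conj_apply, ← MulAut.smul_def,
    ← Subgroup.mem_inv_pointwise_smul_iff, ← h, inv_smul_smul, h]

end PlumbingBad

section LocalDatumBad

variable {F : Type u} {K : Type v} {Fbar : Type w} [Field F] [NumberField F] [Field K] [NumberField K]
  [Algebra F K] [Field Fbar] [Algebra F Fbar] [Algebra K Fbar]
  {E : WeierstrassCurve F} [E.IsElliptic] {l : ℕ} {Pb : BadPlacePredicates K}
  {D : InitialThetaData F K Fbar E l Pb} {CG : D.geom.pe.CuspGalois} {hS : D.CuspClassesNormaliserStable} [Fact l.Prime]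

namespace InitialThetaData

/-- **The normaliser step at any local group over `G_v̲`, from the local arrow law**: if `augGF(H) = G_K ∩ G_v̲` and `H` satisfies the local
arrow law, every element normalising `H` normalises `Π_{X̲_K} ∩ augGF⁻¹ G_v̲` (Def 6.1 (ii) «in a functorial fashion»; [EtTh] Prop 2.4 at bad
places). ([IUTchI] Def 6.1 (ii) p.156) [claim: Mochizuki2012, status: disputed] -/
theorem conj_smul_PiXund_inf_eq_of_law {H : Subgroup D.PiC} (Λ : D.LocalArrowLaw CG hS H) (Gv : Subgroup (Fbar ≃ₐ[F] Fbar))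
    (hmap : H.map D.augGF = galoisSubgroupOf F K Fbar ⊓ Gv) {a : D.PiC} (ha : a ∈ Subgroup.normalizer ((H : Subgroup D.PiC) : Set D.PiC)) :
    MulAut.conj a • (D.PiXund ⊓ Gv.comap D.augGF) = D.PiXund ⊓ Gv.comap D.augGF := by
  have hX : MulAut.conj a • D.PiXund = D.PiXund := by
    ext x
    rw [Subgroup.mem_pointwise_smul_iff_inv_smul_mem, MulAut.smul_def, MulAut.conj_inv_apply]
    have h := (Subgroup.mem_normalizer_iff.mp (Subgroup.inv_mem _ (Λ.normalizer_le ha)) x)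
    rw [inv_inv] at h
    exact h.symm
  rw [D.PiXund_inf_eq_inf_comap_inf Gv, Subgroup.smul_inf, hX, bad_conj_smul_comap_eq, bad_conj_smul_eq_of_map_eq D.augGF hmap ha]

/-- `N(H) ≤ N(Π_{X̲_K} ∩ augGF⁻¹ G_v̲)` under the same hypotheses. ([IUTchI] Def 6.1 (ii) p.156) [claim: Mochizuki2012, status: disputed] -/
theorem normalizer_le_normalizer_PiXund_inf_of_law {H : Subgroup D.PiC} (Λ : D.LocalArrowLaw CG hS H)
    (Gv : Subgroup (Fbar ≃ₐ[F] Fbar)) (hmap : H.map D.augGF = galoisSubgroupOf F K Fbar ⊓ Gv) :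
    Subgroup.normalizer ((H : Subgroup D.PiC) : Set D.PiC) ≤
      Subgroup.normalizer ((D.PiXund ⊓ Gv.comap D.augGF : Subgroup D.PiC) : Set D.PiC) := fun _ ha =>
  bad_mem_normalizer_of_conj_smul_eq (D.conj_smul_PiXund_inf_eq_of_law Λ Gv hmap ha)

namespace LocalDatum

omit [Fact l.Prime] in
/-- A negative element at a bad place: the deck transformation `ι_v̲ ∈ H′ ∖ H` of the SHAPE-OF-RECORD pair (abc-iut-L5-t13
`exists_bad_involution_mem`). ([IUTchI] Ex 3.2 (i) p.69) [claim: Mochizuki2012, status: disputed] -/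
theorem exists_neg_bad {H H' : Subgroup D.PiC} (hle : H ≤ H') (h2 : H.relIndex H' = 2) (hH' : H' ≤ D.PiCund)
    (hinf : H' ⊓ D.PiXund ≤ H) :
    ∃ c ∈ Subgroup.normalizer ((H : Subgroup D.PiC) : Set D.PiC), c ∈ D.PiCund ∧ c ∉ D.PiXund := by
  obtain ⟨c, -, -, hcC, hcX, hcN, -⟩ := D.exists_bad_involution_mem hle h2 hH' hinf
  exact ⟨c, hcN, hcC, hcX⟩

/-- **The local datum of a BAD place `v̲`**: the SHAPE-OF-RECORD pair `H ≤ H′` (`[H′ : H] = 2`, `H′ ≤ Π_{C̲_K}`, `H′ ∩ Π_{X̲_K} ≤ H`) over the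
decomposition group `G_v̲` (`H ≤ Π_{X̲_K} ∩ augGF⁻¹ G_v̲`, `augGF(H) = G_K ∩ G_v̲`) with local arrow law `Λ`: `Hund := Π_{X̲_K} ∩ augGF⁻¹ G_v̲`,
normaliser step from `Λ`, negative element = `ι_v̲`. ([IUTchI] Def 6.1 (ii) p.156) [claim: Mochizuki2012, status: disputed] -/
def ofBad {H H' : Subgroup D.PiC} (hle : H ≤ H') (h2 : H.relIndex H' = 2) (hH' : H' ≤ D.PiCund) (hinf : H' ⊓ D.PiXund ≤ H)
    (Gv : Subgroup (Fbar ≃ₐ[F] Fbar)) (hHv : H ≤ D.PiXund ⊓ Gv.comap D.augGF)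
    (hmap : H.map D.augGF = galoisSubgroupOf F K Fbar ⊓ Gv) (Λ : D.LocalArrowLaw CG hS H) : D.LocalDatum CG hS where
  H := H
  Hund := D.PiXund ⊓ Gv.comap D.augGF
  law := Λ
  le_und := hHv
  und_le := inf_le_left
  normalizer_le_und := D.normalizer_le_normalizer_PiXund_inf_of_law Λ Gv hmap
  exists_neg := exists_neg_bad hle h2 hH' hinf

/-- `(ofBad …).H = H`. ([IUTchI] Def 3.1 (e) p.63) [claim: Mochizuki2012, status: disputed] -/
@[simp] theorem ofBad_H {H H' : Subgroup D.PiC} (hle : H ≤ H') (h2 : H.relIndex H' = 2) (hH' : H' ≤ D.PiCund)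
    (hinf : H' ⊓ D.PiXund ≤ H) (Gv : Subgroup (Fbar ≃ₐ[F] Fbar)) (hHv : H ≤ D.PiXund ⊓ Gv.comap D.augGF)
    (hmap : H.map D.augGF = galoisSubgroupOf F K Fbar ⊓ Gv) (Λ : D.LocalArrowLaw CG hS H) :
    (ofBad hle h2 hH' hinf Gv hHv hmap Λ).H = H := rfl

/-- `(ofBad …).Hund = Π_{X̲_K} ∩ augGF⁻¹ G_v̲`. ([IUTchI] Def 6.1 (ii) p.156) [claim: Mochizuki2012, status: disputed] -/
@[simp] theorem ofBad_Hund {H H' : Subgroup D.PiC} (hle : H ≤ H') (h2 : H.relIndex H' = 2) (hH' : H' ≤ D.PiCund)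
    (hinf : H' ⊓ D.PiXund ≤ H) (Gv : Subgroup (Fbar ≃ₐ[F] Fbar)) (hHv : H ≤ D.PiXund ⊓ Gv.comap D.augGF)
    (hmap : H.map D.augGF = galoisSubgroupOf F K Fbar ⊓ Gv) (Λ : D.LocalArrowLaw CG hS H) :
    (ofBad hle h2 hH' hinf Gv hHv hmap Λ).Hund = D.PiXund ⊓ Gv.comap D.augGF := rfl

end LocalDatum

end InitialThetaData

end LocalDatumBad

end Literature.IUT.HodgeTheaters
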